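import Summits.BirchSwinnertonDyer.BirchSwinnertonDyer.Theorems.GenusKolyvaginAtTwoPowDvdShaCardAtTwoRTKolyvaginClassLevels
import Summits.BirchSwinnertonDyer.BirchSwinnertonDyer.Theorems.KolyvaginRankRigidityAtTwoRegularValueEngineTwoLevel
import HarnessLib

/-!
# Crux U1 `KolyvaginBoundedDefectAtTwo` (stmt-BirchSwinnertonDyer-28083), LINE 17 `kolyvagin_swap` —
# LD · LEVEL DROP AT 2 (pen bsd-idea-1 v7.6–v8.0 support stub `stub_levelDropAtTwo`, statement `LevelDropAtTwo`) — PROVED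

Def-free LANDABLE form of the pen's HOME file `line17/LevelDropAtTwo.lean` (sha16 c34440b925a76365): the theorem is stated with the body
of the skeleton's `LevelDropAtTwo` VERBATIM (no `def … : Prop`), so that inside the skeleton `theorem levelDropAtTwo_holds : LevelDropAtTwo :=
KolyvaginAtTwo.RegularWalk.levelDropAtTwo` closes by definitional unfolding.  `--supports stmt-BirchSwinnertonDyer-28083 --as helper`.
Authored by the pen `bsd-idea-1` g15 (planner; HOME `line17/landable/…LevelDropAtTwo.lean` sha16 198f1334552b93b3, farm rc 0, critic #328);
landed unchanged (route-file import dropped) by width seat `bsd-line-krr2-p2` g18.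
HONEST FRAMING: a support statement of an unregistered skeleton proposal; nothing here proves SWα⁗, U1, a rung or BSD.  BSD is NOT proved.

## Statement
If `c_M(n) ≠ 0` (datum `d`, `M ≥ 1`, `M ≤ M(n)`) and `2^k·[c_M(n), ρ] = 0` for every `ρ ∈ Γ_{K(E[2^M])}`, then `2 ≤ M` and
`2^{k+1}·[c_{M−1}(n), ρ] = 0` for some `ρ ∈ Γ_{K(E[2^{M−1}])}`.

## Proof
`c_M ≠ 0 ⇒ 2 ≤ M` (at `M = 1` the class is `2`-torsion, so `2^{k+1} c_1 = 0` against the visible non-vanishing read at `ρ`);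
McCallum's Lemma 4.6 IN THE TREE `GenusExact.KolyvaginClassLevels.zsmul_kolyvaginClass_eq_torsionH1OfDvd` (`c_{M−1} = ι_* (2 • c_M)` along
`E[2^{M−1}] ↪ E[2^M]`) and the value transport `RegularValueEngine.h1Eval_torsionH1OfDvd` (`[ι_* x, ρ] = ι [x, ρ]`), with
`Γ_{K(E[2^M])} ≤ Γ_{K(E[2^{M−1}])}` (`KolyvaginLowerBoundAtTwo.torsionFixing_le_of_dvd`).
References (locators only): [cite: McCallumLMS1991, §4 Lemma 4.6, Cor. 4.5] [cite: GrossLMS1991, §4 (4.1)–(4.2)].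
Design: no definitions; `K : Type`; axioms `propext`, `Classical.choice`, `Quot.sound`.
-/

set_option autoImplicit false
-- the Theorems namespace of this sub repeats the summit name by design (D-0017 nested layout)
set_option linter.dupNamespace false

noncomputable section

open scoped Classical
open WeierstrassCurve NumberField Field
open Literature.NumberTheory.GaloisRepresentations Literature.NumberTheory.EllipticCurves
open Literature.NumberTheory
open Summit.BirchSwinnertonDyer.BirchSwinnertonDyer.Theorems

namespace Summit.BirchSwinnertonDyer.BirchSwinnertonDyer.Theorems.KolyvaginAtTwo.RegularWalk

universe u

/-- An element of `E[n]` (as a subtype) is killed by `n`. [folklore] -/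
theorem zsmul_self_geomTorsion_eq_zero {k : Type u} [Field k] (V : WeierstrassCurve k) (n : ℤ) (P : geomTorsion V n) :
    n • P = 0 := by
  apply Subtype.ext
  rw [AddSubgroupClass.coe_zsmul, ZeroMemClass.coe_zero]
  exact (mem_geomTorsion_iff V n (P : geomPoints V)).mp P.2

/-- **LD holds** (kernel, sorry-free): level drop for Kolyvagin's classes at `2`, by McCallum's Lemma 4.6 (tree) and the
`h1Eval`/`torsionH1OfDvd` compatibility (tree). [cite: McCallumLMS1991, §4 Lemma 4.6] -/
theorem levelDropAtTwo :
  ∀ (W : WeierstrassCurve ℚ) [W.IsElliptic] [W.IsGloballyMinimal], ¬ W.HasCM → (Literature.NumberTheory.EllipticCurves.Rank1Residual.GoodOrd W 2 ∨ Literature.NumberTheory.EllipticCurves.Rank1Residual.Mult W 2) → (∀ m : ℕ, W.HasSurjectiveModNGaloisRep (2 ^ m : ℕ)) → ∀ (K : Type) [Field K] [NumberField K], Literature.NumberTheory.EllipticCurves.IsImaginaryQuadratic K → ∀ [NeZero (W.conductorNorm ℤ)], Literature.NumberTheory.EllipticCurves.SatisfiesHeegnerHypothesis (W.conductorNorm ℤ)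 K → Odd (NumberField.discr K) → NumberField.discr K ≠ -3 → AddSubgroup.torsionBy (W.baseChange K).toAffine.Point (2 : ℤ) = ⊥ → Literature.NumberTheory.EllipticCurves.SatisfiesHeegnerHypothesis 2 K → ∀ (Dt : Literature.NumberTheory.EllipticCurves.ModularForms.ModularParametrizationData W (W.conductorNorm ℤ)) (β : ℤ) (ι : K →+* ℂ) [∀ k : ℕ, NumberField (ringClassField K ι k)], (4 * (W.conductorNorm ℤ : ℤ)) ∣ β ^ 2 - NumberField.discr K →
    ∀ (n M k : ℕ) (d : Literature.NumberTheory.EllipticCurves.KolyvaginHeegnerData Dt β ι n), 1 ≤ M →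
      (∃ ρ ∈ torsionFixing (W.baseChange K) ((2 ^ M : ℕ) : ℤ),
          ((2 ^ (k + 1) : ℕ) : ℤ) • h1Eval (W.baseChange K) ((2 ^ M : ℕ) : ℤ) (d.kolyvaginClass Nat.prime_two M) ρ ≠ 0) →
      2 ≤ M ∧ ∃ ρ ∈ torsionFixing (W.baseChange K) ((2 ^ (M - 1) : ℕ) : ℤ),
          ((2 ^ k : ℕ) : ℤ) • h1Eval (W.baseChange K) ((2 ^ (M - 1) : ℕ) : ℤ) (d.kolyvaginClass Nat.prime_two (M - 1)) ρ ≠ 0 := by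
  intro W _ _ _ _ _ K _ _ _ _ _ _ _ _ _ Dt β ι _ _ n M k d hM hvis
  obtain ⟨ρ, hρ, hne⟩ := hvis
  -- `c_M(n)` is not the junk value
  have hc : d.kolyvaginClass Nat.prime_two M ≠ 0 := by
    intro h
    apply hne
    rw [h, h1Eval_zero _ _ hρ, smul_zero]
  obtain ⟨hA, hP⟩ := d.kolyvaginClass_ne_zero hc
  -- `M ≥ 2`: at level `1` the value lies in `E[2]` and `2^{k+1}` kills it
  have h2M : 2 ≤ M := by
    by_contra hlt
    have hM1 : M = 1 := by omega
    subst hM1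
    apply hne
    have h2 : ((2 ^ 1 : ℕ) : ℤ) • h1Eval (W.baseChange K) ((2 ^ 1 : ℕ) : ℤ) (d.kolyvaginClass Nat.prime_two 1) ρ = 0 :=
      zsmul_self_geomTorsion_eq_zero _ _ _
    have hsplit : ((2 ^ (k + 1) : ℕ) : ℤ) = ((2 ^ k : ℕ) : ℤ) * ((2 ^ 1 : ℕ) : ℤ) := by push_cast; ring
    rw [hsplit, mul_smul, h2, smul_zero]
  -- the divisibility `2^{M-1} ∣ 2^M` and McCallum's Lemma 4.6
  have hdvd : ((2 ^ (M - 1) : ℕ) : ℤ) ∣ ((2 ^ M : ℕ) : ℤ) :=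
    GenusExact.KolyvaginClassLevels.natCast_pow_dvd_natCast_pow (Nat.sub_le M 1)
  have h46 := GenusExact.KolyvaginClassLevels.zsmul_kolyvaginClass_eq_torsionH1OfDvd d Nat.prime_two (Nat.sub_le M 1) hA hP hdvd
  have hMM : M - (M - 1) = 1 := by omega
  rw [hMM] at h46
  refine ⟨h2M, ρ, KolyvaginLowerBoundAtTwo.torsionFixing_le_of_dvd _ hdvd hρ, ?_⟩
  intro h0
  apply hne
  have hsplit : ((2 ^ (k + 1) : ℕ) : ℤ) = ((2 ^ k : ℕ) : ℤ) * ((2 ^ 1 : ℕ) : ℤ) := by push_cast; ring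
  rw [hsplit, mul_smul, ← h1Eval_zsmul _ _ _ _ hρ, h46,
    KolyvaginAtTwo.RegularValueEngine.h1Eval_torsionH1OfDvd _ hdvd _ hρ, ← map_zsmul, h0, map_zero]

end Summit.BirchSwinnertonDyer.BirchSwinnertonDyer.Theorems.KolyvaginAtTwo.RegularWalk

end
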